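import Literature.Computability.AlgebraicComplexity.BLMW11KroneckerApproximation
import Literature.Computability.AlgebraicComplexity.BLMW11DetStabilizerInvariantsProofs
import Literature.RepresentationTheory.GeneralLinear.WordModelIsotypicSpan
import Literature.RepresentationTheory.FiniteGroups.GroupAlgebraCharacterIdempotents
import Literature.RepresentationTheory.FiniteGroups.SymmetricGroupPowerSumCycles
import Literature.NumberTheory.DiophantineGeometry.SymmetricGroupRepsSignTwist
import Literature.NumberTheory.DiophantineGeometry.PartitionTableauxProofs
import HarnessLib

/-!
# BLMW 2011 §8.3 — Stanley's character formula for rectangular shapes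
# (`BLMW2011_stanley_rectangularCharacter_holds`, proved)

Cell `val-lit` (D-0074 GROUP L), row BLMW11-B, discharge of the named fact
`BLMW2011_stanley_rectangularCharacter` of `BLMW11KroneckerApproximation.lean` (P. Bürgisser,
J. M. Landsberg, L. Manivel, J. Weyman, *An overview of mathematical issues arising in the geometric
complexity theory approach to VP ≠ VNP*, SIAM J. Comput. 40(4) (2011) = arXiv:0907.2850v2, §8.3,
quoting R. P. Stanley, *Irreducible symmetric group characters of rectangular shape*, Sém. Lothar.
Combin. 50 (2003/04) B50d, Thm. 1), in the A13-corrected form typed there: for `w ∈ 𝔖_{δn}`,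
`(∏_{i=1}^{δ} ∏_{j=1}^{n} (i + j - 1)) · χ_{δⁿ}(w) = (-1)^{δn} ∑_{uv = w} n^{κ(u)} (-δ)^{κ(v)}`,
`κ(u)` the number of cycles of `u` (fixed points counted), `δⁿ = Nat.Partition.rectangle n δ`.
Theorems only (no definitions, no named facts). Honest framing: classical character theory of the
symmetric group; VP ≠ VNP is NOT proved and nothing here bears on it.

## Proof (Frobenius' way, through the centre of `ℂ[𝔖_D]`; Stanley's printed proof uses symmetric
## functions, which the tree does not need here)

Write `D = nδ`, `θ(u) = n^{κ(u)}`, `ψ(v) = (-δ)^{κ(v)}`; both are class functions and the right-hand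
sum is the convolution `(θ ⋆ ψ)(w) = ∑_u θ(u) ψ(u⁻¹w)`.

* §1 `κ(u) = #cycleType(u) + #fixed points`; `(-1)^{κ(u)} = (-1)^D sgn(u)`
  (`neg_one_pow_card_parts_partition`); the number of words `[D] → [N]` fixed by `u` is `N^{κ(u)}`
  (`card_fixedWords_eq_pow`, the tree's fixed-word enumerator `F_u = ∏_{cycles} p_{|c|}`
  evaluated at `1`), so `θ` is the character of `𝔖_D` on `(ℂⁿ)^{⊗D}`
  (`character_wordPermRep_eq_pow`) and `ψ = (-1)^D · sgn · χ_{(ℂ^δ)^{⊗D}}`.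
* §2 Schur–Weyl multiplicities in character form: `∑_σ χ_{(ℂ^N)^{⊗D}}(σ) χ^μ(σ) = 0` if
  `ℓ(μ) > N` (`sum_character_wordPermRep_mul_spechtCharacter_eq_zero`, from the tree's
  `isotypicProj_wordPermRep_eq_zero_of_lt`) and `= D!` for the rectangle `μ = (d^m)`, `N = m`
  (`sum_character_wordPermRep_mul_spechtCharacter_rectangle`: the `(d^m)`-isotypic component is the
  `GL_m`-span of the highest-weight space `HW_□` (`range_isotypicProj_wordPermRep`), on which `GL_m`
  acts by `det^d` (`wordRep_eq_det_pow_smul_of_mem_unimodularBorelInvariants`), so it is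
  `HW_□ ≅ [d^m]` itself (`character_hwPermRep`) and `⟨χ^□, χ⟩ = 1`).
* §3 Convolution of class functions on a finite group through the central idempotents
  `e_χ = (χ(1)/|G|) ∑ χ(g⁻¹) g` and central characters `ω_χ` of `ℂ[G]`
  (`GroupAlgebraCharacterIdempotents.lean`):
  `∑_u θ(u)ψ(u⁻¹w) = ∑_{χ ∈ Irr G} (∑ θχ)(∑ ψχ) χ(w⁻¹)/(χ(1)|G|)`
  (`sum_mul_apply_inv_mul_eq_sum_irrChars`, `…_eq_sum_partition` for `𝔖_D`).
* §4 Partitions in the box: `ℓ(λ) ≤ n` and `λ₁ ≤ δ` (`⟸ ℓ(λᵀ) ≤ δ`) with `|λ| = nδ` force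
  `λ = δⁿ` (`parts_eq_rectangle_of_box`); `(δⁿ)ᵀ = n^δ` (`parts_transpose_rectangle`).
* §5 The hook product of the rectangle is `∏_{i ≤ δ, j ≤ n} (i + j - 1)`
  (`prod_hookLength_rectangle`), so `f^{δⁿ} · ∏ (i + j - 1) = D!`
  (`numStandardTableaux_rectangle_mul_prod`, hook length formula
  `numStandardTableaux_mul_prod_hookLength_holds`); `χ^μ(1) = f^μ`.
* §6 Assembly (`BLMW2011_stanley_rectangularCharacter_holds`): by §3 the convolution is
  `∑_λ A_λ B_λ χ^λ(w)/(f^λ D!)` with `A_λ = ∑ n^κ χ^λ = ∑ χ_{(ℂⁿ)^{⊗D}} χ^λ` and, by the sign twist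
  `sgn · χ^λ = χ^{λᵀ}` (`spechtCharacter_transpose`), `B_λ = (-1)^D ∑ χ_{(ℂ^δ)^{⊗D}} χ^{λᵀ}`; by §2
  and §4 only `λ = δⁿ` survives, with `A = D!`, `B = (-1)^D D!`, giving
  `(θ ⋆ ψ)(w) = (-1)^D (D!/f^{δⁿ}) χ_{δⁿ}(w)`, and `D!/f^{δⁿ}` is the hook product (§5).

## References

* [BurgisserEtAl2011] BLMW 2011, §8.3 ("Stanley's character formula").
* [Stanley2003Rectangular] R. P. Stanley, Sém. Lothar. Combin. 50 (2003/04), Art. B50d, Thm. 1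
  (= arXiv:math/0109093).
* [Isaacs1976] I. M. Isaacs, *Character Theory of Finite Groups*, Thm. 2.12, Ch. 3 p. 36 (central
  idempotents and central characters).
* [FultonHarrisGTM129] W. Fulton, J. Harris, *Representation Theory*, §4.1 (4.10) (fixed words and
  power sums), Thm. 6.3 (Schur–Weyl), §15.5.
* [JamesLNM682] G. D. James, LNM 682, 6.6 (`χ^{λ'} = χ^λ ⊗ sgn`).
* [FrameRobinsonThrallCJM1954] hook length formula.

## Tree

`wordPermRep`, `wordRep`, `highestWeightSpace`, `Weight.ofPartition`, `hwPermRep`,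
`character_hwPermRep` (`TensorWordModel`, `WordHighestWeightSpecht`); `isotypicProj`,
`trace_isotypicProj`, `isotypicProj_specht_comp_self`, `isIrrChar_spechtCharacter`,
`spechtCharacter_injective`, `irrChars_toFinset_perm_eq`, `spechtCharacter_inv`, `classInner`
(`IsotypicProjector`, `SymmetricGroupIsotypic`, `InducedClassFunction`);
`range_isotypicProj_wordPermRep`, `isotypicProj_wordPermRep_eq_zero_of_lt` (`WordModelIsotypicSpan`);
`unimodularBorelInvariants_eq_highestWeightSpace`, `Nat.Partition.parts_rectangle`,
`Nat.Partition.sortedParts_rectangle`, `Nat.Partition.card_parts_rectangle_le`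
(`SchurWeylPlethysmKroneckerBoundProofs`); `wordRep_eq_det_pow_smul_of_mem_unimodularBorelInvariants`
(`BLMW11DetStabilizerInvariantsProofs`); `charIdempotent`, `centralChar`, `coeff_charIdempotent`,
`sum_smul_of_mem_center_of_isClassFun`, `eq_sum_centralChar_smul_charIdempotent`,
`mul_charIdempotent_of_mem_center`, `centralChar_sum_smul_of` (`GroupAlgebraCharacterIdempotents`);
`fixedWordPoly`, `fixedWordPoly_eq_prod_cycleType` (`SymmetricGroupFixedWords`,
`SymmetricGroupPowerSumCycles`); `spechtCharacter_transpose`, `Nat.Partition.transpose`,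
`Nat.Partition.youngDiagram_transpose` (`SymmetricGroupRepsSignTwist`, `PartitionTableaux`);
`hookLength`, `numStandardTableaux`, `numStandardTableaux_mul_prod_hookLength_holds`,
`finrank_spechtIdeal_holds` (`PartitionTableaux(Proofs)`, `SymmetricGroupRepsFinrankSpechtProofs`).
Mathlib: `Equiv.Perm.partition`, `parts_partition`, `sum_cycleType`, `sign_of_cycleType`,
`MonoidAlgebra.coeff_single_mul_apply`, `LinearMap.IsProj.trace`,
`LinearMap.isProj_range_iff_isIdempotentElem`, `LinearMap.trace_eq_matrix_trace`,
`Finset.prod_range_reflect`, `YoungDiagram.mem_iff_lt_rowLen/colLen`.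
-/

noncomputable section

open scoped BigOperators
open Finset Module

namespace Literature.Computability.AlgebraicComplexity

open _root_.Literature.NumberTheory.DiophantineGeometry
open _root_.Literature.RepresentationTheory.FiniteGroups
open _root_.Literature.RepresentationTheory.GeneralLinear

/-! ### §1 Cycle counts: `κ(u)`, `(-1)^{κ(u)} = (-1)^D sgn(u)`, fixed words -/

section Cycles

variable {D : ℕ}

/-- `κ(σ)` (the number of parts of the cycle-type partition, fixed points counted) is the number
of non-trivial cycles plus the number of fixed points: `κ(σ) = #cycleType(σ) + (D - |supp σ|)`.
[cite: FultonHarrisGTM129, §4.1 (cycle type of a permutation)] -/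
theorem card_parts_partition (σ : Equiv.Perm (Fin D)) :
    (Equiv.Perm.partition σ).parts.card =
      Multiset.card σ.cycleType + (D - σ.cycleType.sum) := by
  rw [Equiv.Perm.parts_partition, Multiset.card_add, Multiset.card_replicate,
    Equiv.Perm.sum_cycleType, Fintype.card_fin]

/-- `κ` is a class function: conjugate permutations have the same cycle type.
[cite: FultonHarrisGTM129, §4.1 (cycle type of a permutation)] -/
theorem card_parts_partition_conj (σ τ : Equiv.Perm (Fin D)) :
    (Equiv.Perm.partition (τ * σ * τ⁻¹)).parts.card = (Equiv.Perm.partition σ).parts.card := by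
  have h : IsConj σ (τ * σ * τ⁻¹) := isConj_iff.mpr ⟨τ, rfl⟩
  rw [← Equiv.Perm.partition_eq_of_isConj.mp h]

/-- `κ(σ⁻¹) = κ(σ)`. [cite: FultonHarrisGTM129, §4.1 (cycle type of a permutation)] -/
theorem card_parts_partition_inv (σ : Equiv.Perm (Fin D)) :
    (Equiv.Perm.partition σ⁻¹).parts.card = (Equiv.Perm.partition σ).parts.card := by
  have h : IsConj σ σ⁻¹ :=
    Equiv.Perm.isConj_iff_cycleType_eq.2 (Equiv.Perm.cycleType_inv σ).symm
  rw [← Equiv.Perm.partition_eq_of_isConj.mp h]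

/-- **`(-1)^{κ(σ)} = (-1)^D · sgn(σ)`** (`sgn(σ) = (-1)^{D - κ(σ)}`), in any commutative ring
(Stanley, proof of Thm. 1: "`ε_w = (-1)^{n - κ(w)}`"). [cite: Stanley2003Rectangular, §2 (proof of Thm. 1)] -/
theorem neg_one_pow_card_parts_partition {R : Type*} [CommRing R] (σ : Equiv.Perm (Fin D)) :
    (-1 : R) ^ (Equiv.Perm.partition σ).parts.card = (-1) ^ D * ((Equiv.Perm.sign σ : ℤ) : R) := by
  rw [card_parts_partition, Equiv.Perm.sign_of_cycleType, Units.val_pow_eq_pow_val, Units.val_neg,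
    Units.val_one, Int.cast_pow, Int.cast_neg, Int.cast_one, ← pow_add]
  have hle : σ.cycleType.sum ≤ D := by
    simpa only [Fintype.card_fin] using Equiv.Perm.sum_cycleType_le σ
  set a := Multiset.card σ.cycleType + (D - σ.cycleType.sum) with ha
  set b := D + (σ.cycleType.sum + Multiset.card σ.cycleType) with hb
  have hab : Even (a + b) := ⟨Multiset.card σ.cycleType + D, by omega⟩
  calc (-1 : R) ^ a = (-1) ^ a * ((-1) ^ b * (-1) ^ b) := by
        rw [← pow_add, Even.neg_one_pow ⟨b, rfl⟩, mul_one]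
    _ = (-1) ^ (a + b) * (-1) ^ b := by rw [pow_add (-1 : R) a b, mul_assoc]
    _ = (-1) ^ b := by rw [Even.neg_one_pow hab, one_mul]

/-- Evaluating a power sum at `x = (1, …, 1)` gives the number of variables. [folklore] -/
private theorem eval_one_psum (N c : ℕ) :
    MvPolynomial.eval (fun _ => (1 : ℤ)) (MvPolynomial.psum (Fin N) ℤ c) = N := by
  rw [MvPolynomial.psum, map_sum]
  simp_rw [map_pow, MvPolynomial.eval_X, one_pow]
  rw [Finset.sum_const, Finset.card_univ, Fintype.card_fin, nsmul_eq_mul, mul_one]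

/-- **The number of words `w : [D] → [N]` fixed by `σ` is `N^{κ(σ)}`** (a fixed word is constant
on every cycle): the fixed-word enumerator `F_σ = ∏_{cycles} p_{|c|}` (tree
`fixedWordPoly_eq_prod_cycleType`) evaluated at `x = (1, …, 1)`.
[cite: FultonHarrisGTM129, §4.1 (4.10)] -/
theorem card_fixedWords_eq_pow (N : ℕ) (σ : Equiv.Perm (Fin D)) :
    ((univ.filter fun w : Fin D → Fin N => w ∘ ⇑σ = w).card : ℤ) =
      (N : ℤ) ^ (Equiv.Perm.partition σ).parts.card := by
  classical
  have h := congrArg (MvPolynomial.eval (fun _ => (1 : ℤ))) (fixedWordPoly_eq_prod_cycleType (N := N) σ)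
  rw [fixedWordPoly, map_sum] at h
  simp_rw [map_prod, MvPolynomial.eval_X, Finset.prod_const_one] at h
  rw [Finset.sum_const, nsmul_eq_mul, mul_one, map_mul, map_pow, eval_one_psum] at h
  rw [h, card_parts_partition, pow_add, Fintype.card_fin]
  congr 1
  rw [← Multiset.prod_hom']
  simp only [eval_one_psum, Multiset.map_const', Multiset.prod_replicate]

/-- **The character of `𝔖_D` on the word space `(k^N)^{⊗D}` counts fixed words**:
`χ(σ) = #{w : [D] → [N] | w ∘ σ = w}` (the permutation matrix of `σ` on the basis of words).
[cite: FultonHarrisGTM129, §4.1 (4.10)] -/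
theorem character_wordPermRep_eq_card (k : Type*) [Field k] (N : ℕ) (σ : Equiv.Perm (Fin D)) :
    (wordPermRep k N D).character σ =
      ((univ.filter fun w : Fin D → Fin N => w ∘ ⇑σ = w).card : k) := by
  classical
  rw [Representation.character, LinearMap.trace_eq_matrix_trace k (Pi.basisFun k (Word N D)),
    Matrix.trace, Finset.card_filter, Nat.cast_sum]
  refine Finset.sum_congr rfl fun w _ => ?_
  rw [Matrix.diag_apply, LinearMap.toMatrix_apply, Pi.basisFun_repr, Pi.basisFun_apply,
    wordPermRep_apply, wordPerm_apply, Nat.cast_ite, Nat.cast_one, Nat.cast_zero]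
  by_cases h : w ∘ ⇑σ = w
  · rw [if_pos h, h, Pi.single_eq_same]
  · rw [if_neg h, Pi.single_eq_of_ne h]

/-- **`χ_{(k^N)^{⊗D}}(σ) = N^{κ(σ)}`**. [cite: FultonHarrisGTM129, §4.1 (4.10)] -/
theorem character_wordPermRep_eq_pow (k : Type*) [Field k] (N : ℕ) (σ : Equiv.Perm (Fin D)) :
    (wordPermRep k N D).character σ = (N : k) ^ (Equiv.Perm.partition σ).parts.card := by
  rw [character_wordPermRep_eq_card]
  have h := card_fixedWords_eq_pow N σ
  have h' : (((univ.filter fun w : Fin D → Fin N => w ∘ ⇑σ = w).card : ℤ) : k) =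
      (((N : ℤ) ^ (Equiv.Perm.partition σ).parts.card : ℤ) : k) := by rw [h]
  simpa using h'

end Cycles

/-! ### §2 Schur–Weyl multiplicities: `∑_σ χ_{(k^N)^{⊗D}}(σ) χ^μ(σ)` -/

section Multiplicity

variable {D : ℕ}

/-- `|𝔖_D| · ⟨χ^μ, χ_ρ⟩ = ∑_σ χ_ρ(σ) χ^μ(σ)` (the Specht characters are real: `χ^μ(σ⁻¹) = χ^μ(σ)`).
[folklore] -/
private theorem card_mul_classInner_spechtCharacter {V : Type*} [AddCommGroup V] [Module ℂ V]
    [FiniteDimensional ℂ V] (ρ : Representation ℂ (Equiv.Perm (Fin D)) V) (μ : Nat.Partition D) :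
    ((D.factorial : ℕ) : ℂ) * classInner (spechtCharacter ℂ μ) ρ.character =
      ∑ σ : Equiv.Perm (Fin D), ρ.character σ * spechtCharacter ℂ μ σ := by
  rw [classInner_comm, classInner_apply, Fintype.card_perm, Fintype.card_fin, ← mul_assoc,
    mul_inv_cancel₀ (Nat.cast_ne_zero.mpr (Nat.factorial_ne_zero D)), one_mul]
  exact Finset.sum_congr rfl fun σ _ => by rw [RepresentationTheory.FiniteGroups.spechtCharacter_inv]

/-- **Schur–Weyl vanishing in character form**: `∑_σ χ_{(ℂ^N)^{⊗D}}(σ) χ^μ(σ) = 0` when `μ` has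
more than `N` parts (`S_μ(ℂ^N) = 0`, so `[μ]` does not occur in `(ℂ^N)^{⊗D}`; the trace of the
isotypic projector `P_μ = 0`, tree `isotypicProj_wordPermRep_eq_zero_of_lt`).
[cite: FultonHarrisGTM129, Thm. 6.3 (1)] -/
theorem sum_character_wordPermRep_mul_spechtCharacter_eq_zero {N : ℕ} (μ : Nat.Partition D)
    (hμ : N < μ.parts.card) :
    ∑ σ : Equiv.Perm (Fin D), (wordPermRep ℂ N D).character σ * spechtCharacter ℂ μ σ = 0 := by
  have htr := trace_isotypicProj (wordPermRep ℂ N D) (spechtCharacter ℂ μ)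
  rw [isotypicProj_wordPermRep_eq_zero_of_lt hμ, map_zero] at htr
  have h0 : classInner (spechtCharacter ℂ μ) (wordPermRep ℂ N D).character = 0 := by
    rcases mul_eq_zero.mp htr.symm with h | h
    · exact absurd h (isIrrChar_spechtCharacter μ).apply_one_ne_zero
    · exact h
  rw [← card_mul_classInner_spechtCharacter, h0, mul_zero]

/-- **The rectangle occurs once**: `∑_σ χ_{(ℂ^m)^{⊗md}}(σ) χ^{(d^m)}(σ) = (md)!`, i.e. `[d^m]`
has multiplicity `dim S_{(d^m)}(ℂ^m) = dim (det)^{⊗d} = 1` in `(ℂ^m)^{⊗md}`. Proof: the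
`(d^m)`-isotypic component is the `GL_m`-span of the highest-weight vectors of weight `(d,…,d)`
(tree `range_isotypicProj_wordPermRep`), on which `GL_m` acts by `det^d`
(`wordRep_eq_det_pow_smul_of_mem_unimodularBorelInvariants`), so it IS the highest-weight space
`HW_□ ≅ [d^m]` (`character_hwPermRep`); hence `tr P_□ = f^{(d^m)}` and `⟨χ^□, χ⟩ = 1`.
[cite: FultonHarrisGTM129, Thm. 6.3 (2),(4)] -/
theorem sum_character_wordPermRep_mul_spechtCharacter_rectangle (m d : ℕ) :
    ∑ σ : Equiv.Perm (Fin (m * d)), (wordPermRep ℂ m (m * d)).character σ *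
        spechtCharacter ℂ (Nat.Partition.rectangle m d) σ = (((m * d).factorial : ℕ) : ℂ) := by
  classical
  set R := Nat.Partition.rectangle m d with hR
  set P := isotypicProj (wordPermRep ℂ m (m * d)) (spechtCharacter ℂ R) with hP
  set HW := highestWeightSpace (wordRep ℂ m (m * d)) (Weight.ofPartition m R) with hHW
  -- the range of `P` is `HW`
  have hrange : LinearMap.range P = HW := by
    rw [hP, range_isotypicProj_wordPermRep (N := m) R]
    apply le_antisymm
    · refine Submodule.span_le.mpr ?_
      rintro _ ⟨⟨g, ξ⟩, rfl⟩
      have hξ : (ξ : Word m (m * d) → ℂ) ∈ unimodularBorelInvariants ℂ m (m * d) := by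
        rw [unimodularBorelInvariants_eq_highestWeightSpace ℂ]; exact ξ.2
      change wordRep ℂ m (m * d) g (ξ : Word m (m * d) → ℂ) ∈ HW
      rw [wordRep_eq_det_pow_smul_of_mem_unimodularBorelInvariants ℂ hξ g]
      exact HW.smul_mem _ ξ.2
    · intro v hv
      refine Submodule.subset_span ⟨⟨1, ⟨v, hv⟩⟩, ?_⟩
      simp
  -- `P` is a projection onto its range, so `tr P = dim HW = χ^R(1)`
  have hproj : LinearMap.IsProj (LinearMap.range P) P :=
    (LinearMap.isProj_range_iff_isIdempotentElem P).mpr (isotypicProj_specht_comp_self _ R)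
  have htr1 : LinearMap.trace ℂ _ P = (finrank ℂ HW : ℂ) := by rw [hproj.trace, hrange]
  have hfin : (finrank ℂ HW : ℂ) = spechtCharacter ℂ R 1 := by
    rw [← character_hwPermRep ℂ R (Nat.Partition.card_parts_rectangle_le m d), Representation.char_one]
  have htr2 := trace_isotypicProj (wordPermRep ℂ m (m * d)) (spechtCharacter ℂ R)
  rw [htr1, hfin] at htr2
  have h1 : classInner (spechtCharacter ℂ R) (wordPermRep ℂ m (m * d)).character = 1 := by
    have hne := (isIrrChar_spechtCharacter R).apply_one_ne_zero
    calc classInner (spechtCharacter ℂ R) (wordPermRep ℂ m (m * d)).character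
        = (spechtCharacter ℂ R 1)⁻¹ * (spechtCharacter ℂ R 1 *
            classInner (spechtCharacter ℂ R) (wordPermRep ℂ m (m * d)).character) := by
          rw [← mul_assoc, inv_mul_cancel₀ hne, one_mul]
      _ = 1 := by rw [← htr2, inv_mul_cancel₀ hne]
  rw [← card_mul_classInner_spechtCharacter, h1, mul_one]

end Multiplicity

/-! ### §3 Convolution of class functions through the central idempotents of `ℂ[G]` -/

section Convolution

variable {G : Type} [Group G] [Fintype G] [DecidableEq G]

/-- The coefficients of `∑_g f(g) g ∈ ℂ[G]` are the values of `f`. [folklore] -/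
private theorem coeff_sum_smul_of (f : G → ℂ) (g : G) :
    (∑ x : G, f x • MonoidAlgebra.of ℂ G x).coeff g = f g := by
  rw [MonoidAlgebra.coeff_sum, Finsupp.finsetSum_apply]
  simp_rw [MonoidAlgebra.coeff_smul_apply, MonoidAlgebra.of_apply, MonoidAlgebra.coeff_single,
    Finsupp.single_apply, smul_eq_mul, mul_ite, mul_one, mul_zero]
  rw [Finset.sum_ite_eq' Finset.univ g, if_pos (Finset.mem_univ g)]

/-- The `w`-coefficient of the product `(∑_u θ(u) u)(∑_v ψ(v) v)` in `ℂ[G]` is the convolution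
`∑_u θ(u) ψ(u⁻¹ w)`. [folklore] -/
private theorem coeff_sum_smul_of_mul (θ ψ : G → ℂ) (w : G) :
    ((∑ u : G, θ u • MonoidAlgebra.of ℂ G u) * (∑ v : G, ψ v • MonoidAlgebra.of ℂ G v)).coeff w =
      ∑ u : G, θ u * ψ (u⁻¹ * w) := by
  rw [Finset.sum_mul, MonoidAlgebra.coeff_sum, Finsupp.finsetSum_apply]
  refine Finset.sum_congr rfl fun u _ => ?_
  rw [smul_mul_assoc, MonoidAlgebra.coeff_smul_apply, smul_eq_mul, MonoidAlgebra.of_apply,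
    MonoidAlgebra.coeff_single_mul_apply, one_mul, coeff_sum_smul_of]

/-- **Convolution of class functions** (Frobenius): for class functions `θ, ψ` on a finite group,
`∑_{u ∈ G} θ(u) ψ(u⁻¹w) = ∑_{χ ∈ Irr(G)} (∑_g θ(g)χ(g)) (∑_g ψ(g)χ(g)) χ(w⁻¹) / (χ(1)|G|)` — the
product of the central elements `∑ θ(g) g`, `∑ ψ(g) g` of `ℂ[G]` expanded in the central
idempotents `e_χ` (`z = ∑_χ ω_χ(z) e_χ`, `ω_χ` multiplicative on the centre; Isaacs Thm. 2.12 and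
Ch. 3 p. 36). [cite: Isaacs1976, Thm. 2.12 and Ch. 3 p. 36] -/
theorem sum_mul_apply_inv_mul_eq_sum_irrChars {θ ψ : G → ℂ} (hθ : IsClassFun θ)
    (hψ : IsClassFun ψ) (w : G) :
    ∑ u : G, θ u * ψ (u⁻¹ * w) =
      ∑ χ ∈ (irrChars_finite_holds G).toFinset,
        (∑ g : G, θ g * χ g) * (∑ g : G, ψ g * χ g) * χ w⁻¹ / (χ 1 * Fintype.card G) := by
  have hcθ : (∑ u : G, θ u • MonoidAlgebra.of ℂ G u) ∈ Subalgebra.center ℂ (MonoidAlgebra ℂ G) :=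
    sum_smul_of_mem_center_of_isClassFun hθ
  have hcψ : (∑ v : G, ψ v • MonoidAlgebra.of ℂ G v) ∈ Subalgebra.center ℂ (MonoidAlgebra ℂ G) :=
    sum_smul_of_mem_center_of_isClassFun hψ
  have hprod : (∑ u : G, θ u • MonoidAlgebra.of ℂ G u) * (∑ v : G, ψ v • MonoidAlgebra.of ℂ G v) =
      ∑ χ ∈ (irrChars_finite_holds G).toFinset,
        (centralChar χ (∑ u : G, θ u • MonoidAlgebra.of ℂ G u) *
          centralChar χ (∑ v : G, ψ v • MonoidAlgebra.of ℂ G v)) • charIdempotent χ := by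
    conv_lhs => rw [eq_sum_centralChar_smul_charIdempotent hcψ, Finset.mul_sum]
    refine Finset.sum_congr rfl fun χ hχ => ?_
    have hirr : IsIrrChar G χ := (irrChars_finite_holds G).mem_toFinset.mp hχ
    rw [mul_smul_comm, mul_charIdempotent_of_mem_center hcθ hirr, smul_smul, mul_comm]
  rw [← coeff_sum_smul_of_mul θ ψ w, hprod, MonoidAlgebra.coeff_sum, Finsupp.finsetSum_apply]
  refine Finset.sum_congr rfl fun χ hχ => ?_
  have hirr : IsIrrChar G χ := (irrChars_finite_holds G).mem_toFinset.mp hχ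
  have h1 : χ 1 ≠ 0 := hirr.apply_one_ne_zero
  have hG : (Fintype.card G : ℂ) ≠ 0 := Nat.cast_ne_zero.mpr Fintype.card_ne_zero
  rw [MonoidAlgebra.coeff_smul_apply, smul_eq_mul, coeff_charIdempotent, centralChar_sum_smul_of,
    centralChar_sum_smul_of]
  field_simp

end Convolution

section ConvolutionPerm

variable {D : ℕ}

/-- **Convolution of class functions on `𝔖_D`**: `∑_u θ(u) ψ(u⁻¹w) =
∑_{μ ⊢ D} (∑_g θ(g)χ^μ(g)) (∑_g ψ(g)χ^μ(g)) χ^μ(w) / (f^μ · D!)` (the irreducible characters of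
`𝔖_D` are the Specht characters, which are real). [cite: Isaacs1976, Thm. 2.12 and Ch. 3 p. 36] -/
theorem sum_mul_apply_inv_mul_eq_sum_partition {θ ψ : Equiv.Perm (Fin D) → ℂ} (hθ : IsClassFun θ)
    (hψ : IsClassFun ψ) (w : Equiv.Perm (Fin D)) :
    ∑ u : Equiv.Perm (Fin D), θ u * ψ (u⁻¹ * w) =
      ∑ μ : Nat.Partition D, (∑ g, θ g * spechtCharacter ℂ μ g) *
        (∑ g, ψ g * spechtCharacter ℂ μ g) * spechtCharacter ℂ μ w /
          (spechtCharacter ℂ μ 1 * (D.factorial : ℂ)) := by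
  classical
  rw [sum_mul_apply_inv_mul_eq_sum_irrChars hθ hψ w, irrChars_toFinset_perm_eq,
    Finset.sum_image fun μ _ ν _ h => spechtCharacter_injective h]
  refine Finset.sum_congr rfl fun μ _ => ?_
  rw [RepresentationTheory.FiniteGroups.spechtCharacter_inv, Fintype.card_perm, Fintype.card_fin]

end ConvolutionPerm

/-! ### §4 Partitions in the `n × δ` box: only the rectangle `δⁿ` has `ℓ(λ) ≤ n` and `λ₁ ≤ δ` -/

section Box

variable {d : ℕ}

/-- The number of parts of `μ` is the length of the first column of its Young diagram
(as in `DIP20MonomialCounts.card_parts_eq_colLen_zero`, restated to keep the imports light).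
[folklore] -/
private theorem card_parts_eq_colLen_zero' (μ : Nat.Partition d) :
    μ.parts.card = μ.youngDiagram.colLen 0 := by
  rw [← μ.length_sortedParts, ← μ.rowLens_youngDiagram, YoungDiagram.length_rowLens]

/-- The parts of `μ` are the row lengths of its Young diagram. [folklore] -/
private theorem mem_parts_iff_exists_rowLen' (μ : Nat.Partition d) (x : ℕ) :
    x ∈ μ.parts ↔ ∃ i < μ.youngDiagram.colLen 0, μ.youngDiagram.rowLen i = x := by
  have h1 : x ∈ μ.parts ↔ x ∈ μ.sortedParts := (Multiset.mem_sort _).symm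
  rw [h1, ← μ.rowLens_youngDiagram, YoungDiagram.rowLens, List.mem_map]
  simp only [List.mem_range]

/-- Every part is at most the first row. [folklore] -/
private theorem le_rowLen_zero_of_mem_parts (μ : Nat.Partition d) {x : ℕ} (hx : x ∈ μ.parts) :
    x ≤ μ.youngDiagram.rowLen 0 := by
  obtain ⟨i, -, rfl⟩ := (mem_parts_iff_exists_rowLen' μ x).mp hx
  exact μ.youngDiagram.rowLen_anti 0 i (Nat.zero_le _)

/-- The transpose has `λ₁` parts (as in `DIP20MonomialCounts.card_parts_transpose`). [folklore] -/
private theorem card_parts_transpose' (μ : Nat.Partition d) :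
    μ.transpose.parts.card = μ.youngDiagram.rowLen 0 := by
  rw [card_parts_eq_colLen_zero', μ.youngDiagram_transpose, YoungDiagram.colLen_transpose]

/-- **If `ℓ(λᵀ) ≤ δ` then every part of `λ` is `≤ δ`** (`ℓ(λᵀ) = λ₁`).
[cite: FultonYoungTableaux1997, §0 (the conjugate partition)] -/
theorem forall_parts_le_of_card_parts_transpose_le (μ : Nat.Partition d) {δ : ℕ}
    (h : μ.transpose.parts.card ≤ δ) : ∀ x ∈ μ.parts, x ≤ δ := fun _ hx =>
  (le_rowLen_zero_of_mem_parts μ hx).trans ((card_parts_transpose' μ).symm.le.trans h)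

/-- **A partition of `nδ` with at most `n` parts, all `≤ δ`, is the rectangle `δⁿ`** (as multisets
of parts: `λ.parts = (rectangle n δ).parts`; the sum forces every part to be `δ` and their number
to be `n`). [cite: FultonYoungTableaux1997, §0 (Young diagrams of partitions)] -/
theorem parts_eq_rectangle_of_box {D n δ : ℕ} (μ : Nat.Partition D) (hD : D = n * δ)
    (h1 : μ.parts.card ≤ n) (h2 : ∀ x ∈ μ.parts, x ≤ δ) :
    μ.parts = (Nat.Partition.rectangle n δ).parts := by
  rw [Nat.Partition.parts_rectangle]
  rcases Nat.eq_zero_or_pos δ with hδ | hδ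
  · subst hδ
    have h0 : μ.parts = 0 := by
      by_contra hne
      obtain ⟨x, hx⟩ := Multiset.exists_mem_of_ne_zero hne
      have := μ.parts_pos hx
      have := h2 x hx
      omega
    rw [h0, eq_comm, Multiset.filter_eq_nil]
    intro a ha
    rw [Multiset.eq_of_mem_replicate ha]
    exact fun h => h rfl
  · rw [Multiset.filter_eq_self.mpr fun a ha => by rw [Multiset.eq_of_mem_replicate ha]; exact hδ.ne',
      Multiset.eq_replicate]
    -- the sum of the parts is `n δ ≤ (#parts) δ ≤ n δ`
    have hsum : μ.parts.sum = n * δ := by rw [μ.parts_sum, hD]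
    have hle : μ.parts.sum ≤ μ.parts.card * δ := by
      simpa [smul_eq_mul] using Multiset.sum_le_card_nsmul μ.parts δ h2
    have hcard : μ.parts.card = n := by
      refine le_antisymm h1 ?_
      have : n * δ ≤ μ.parts.card * δ := hsum ▸ hle
      exact Nat.le_of_mul_le_mul_right this hδ
    refine ⟨hcard, fun x hx => ?_⟩
    by_contra hne
    have hlt : x < δ := lt_of_le_of_ne (h2 x hx) hne
    obtain ⟨t, ht⟩ := Multiset.exists_cons_of_mem hx
    have hle' : t.sum ≤ t.card * δ := by
      simpa [smul_eq_mul] using Multiset.sum_le_card_nsmul t δ fun a ha => h2 a (by rw [ht]; exact Multiset.mem_cons_of_mem ha)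
    have hct : μ.parts.card = t.card + 1 := by rw [ht, Multiset.card_cons]
    have : μ.parts.sum = x + t.sum := by rw [ht, Multiset.sum_cons]
    have key : μ.parts.sum < μ.parts.card * δ := by
      rw [this, hct, add_mul, one_mul, add_comm x]
      exact add_lt_add_of_le_of_lt hle' hlt
    rw [hsum, hcard] at key
    exact lt_irrefl _ key

/-- The first row of the rectangle `δⁿ` has length `≤ δ`. [folklore] -/
private theorem rowLen_zero_rectangle_le (n δ : ℕ) :
    (Nat.Partition.rectangle n δ).youngDiagram.rowLen 0 ≤ δ := by
  by_contra h
  rw [not_le] at h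
  have hmem : (0, δ) ∈ (Nat.Partition.rectangle n δ).youngDiagram :=
    YoungDiagram.mem_iff_lt_rowLen.mpr h
  rw [Nat.Partition.mem_youngDiagram_iff] at hmem
  obtain ⟨hlen, hlt⟩ := hmem
  rcases Nat.eq_zero_or_pos δ with hδ | hδ
  · subst hδ
    have h0 : (Nat.Partition.rectangle n 0).parts.card = 0 := by
      rw [Nat.Partition.parts_rectangle, Multiset.card_eq_zero, Multiset.filter_eq_nil]
      intro a ha
      rw [Multiset.eq_of_mem_replicate ha]
      exact fun h => h rfl
    simp only [Nat.Partition.length_sortedParts, h0, Nat.not_lt_zero] at hlen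
  · have hsp := Nat.Partition.sortedParts_rectangle n δ hδ.ne'
    simp only [hsp, List.getElem_replicate, List.length_replicate] at hlt hlen
    exact lt_irrefl _ hlt

/-- **The transpose of the rectangle `δⁿ` is the rectangle `n^δ`** (as multisets of parts).
[cite: FultonYoungTableaux1997, §0 (the conjugate partition)] -/
theorem parts_transpose_rectangle (n δ : ℕ) :
    (Nat.Partition.rectangle n δ).transpose.parts = (Nat.Partition.rectangle δ n).parts := by
  refine parts_eq_rectangle_of_box _ (mul_comm n δ) ?_ ?_
  · rw [card_parts_transpose']
    exact rowLen_zero_rectangle_le n δ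
  · refine forall_parts_le_of_card_parts_transpose_le _ ?_
    rw [card_parts_transpose', μ_rowLen_zero_transpose]
    exact Nat.Partition.card_parts_rectangle_le n δ
  where
  /-- auxiliary: the first row of `μᵀ` is `ℓ(μ)` -/
  μ_rowLen_zero_transpose : (Nat.Partition.rectangle n δ).transpose.youngDiagram.rowLen 0 =
      (Nat.Partition.rectangle n δ).parts.card := by
    rw [Nat.Partition.youngDiagram_transpose, YoungDiagram.rowLen_transpose, card_parts_eq_colLen_zero']

end Box

/-! ### §5 The hook product of the rectangle `δⁿ`: `f^{δⁿ} · ∏_{i ≤ δ, j ≤ n} (i + j - 1) = (nδ)!` -/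

section Hook

/-- The Young diagram of the rectangle `δⁿ` is the box `[0, n) × [0, δ)` (as in
`KroneckerRectangularStability.mem_youngDiagram_rectangle_iff`, restated to keep the imports
light). [folklore] -/
private theorem mem_youngDiagram_rectangle' (n δ : ℕ) (c : ℕ × ℕ) :
    c ∈ (Nat.Partition.rectangle n δ).youngDiagram ↔ c.1 < n ∧ c.2 < δ := by
  rw [Nat.Partition.mem_youngDiagram_iff]
  rcases Nat.eq_zero_or_pos δ with hδ | hδ
  · subst hδ
    have h0 : (Nat.Partition.rectangle n 0).parts.card = 0 := by
      rw [Nat.Partition.parts_rectangle, Multiset.card_eq_zero, Multiset.filter_eq_nil]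
      intro a ha
      rw [Multiset.eq_of_mem_replicate ha]
      exact fun h => h rfl
    constructor
    · rintro ⟨h, -⟩
      rw [Nat.Partition.length_sortedParts, h0] at h
      exact absurd h (Nat.not_lt_zero _)
    · rintro ⟨-, h⟩
      exact absurd h (Nat.not_lt_zero _)
  · simp [Nat.Partition.sortedParts_rectangle n δ hδ.ne']

/-- The cells of the rectangle `δⁿ`. [folklore] -/
private theorem cells_rectangle (n δ : ℕ) :
    (Nat.Partition.rectangle n δ).youngDiagram.cells = Finset.range n ×ˢ Finset.range δ := by
  ext c
  rw [YoungDiagram.mem_cells, mem_youngDiagram_rectangle', Finset.mem_product, Finset.mem_range,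
    Finset.mem_range]

/-- Rows of the rectangle have length `δ`. [folklore] -/
private theorem rowLen_rectangle {n δ a : ℕ} (ha : a < n) :
    (Nat.Partition.rectangle n δ).youngDiagram.rowLen a = δ := by
  have key : ∀ j, j < (Nat.Partition.rectangle n δ).youngDiagram.rowLen a ↔ j < δ := fun j => by
    rw [← YoungDiagram.mem_iff_lt_rowLen, mem_youngDiagram_rectangle']
    exact ⟨fun h => h.2, fun h => ⟨ha, h⟩⟩
  refine le_antisymm (not_lt.1 fun h => ?_) (not_lt.1 fun h => ?_)
  · exact lt_irrefl _ ((key _).1 h)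
  · exact lt_irrefl _ ((key _).2 h)

/-- Columns of the rectangle have length `n` (for columns `< δ`). [folklore] -/
private theorem colLen_rectangle {n δ b : ℕ} (hb : b < δ) :
    (Nat.Partition.rectangle n δ).youngDiagram.colLen b = n := by
  have key : ∀ i, i < (Nat.Partition.rectangle n δ).youngDiagram.colLen b ↔ i < n := fun i => by
    rw [← YoungDiagram.mem_iff_lt_colLen, mem_youngDiagram_rectangle']
    exact ⟨fun h => h.1, fun h => ⟨h, hb⟩⟩
  refine le_antisymm (not_lt.1 fun h => ?_) (not_lt.1 fun h => ?_)
  · exact lt_irrefl _ ((key _).1 h)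
  · exact lt_irrefl _ ((key _).2 h)

/-- **The hook product of the rectangle**: `∏_{c ∈ δⁿ} h(c) = ∏_{i=1}^{δ} ∏_{j=1}^{n} (i + j - 1)`
(the hook of the box in row `a`, column `b` has length `(δ - b) + (n - a) - 1`; reflect both
indices; Stanley: "`f^{p×q} = (pq)!/∏ h(u)`", the hook lengths of `p × q` being the `i + j - 1`).
[cite: Stanley2003Rectangular, §1 (Thm. 1, normalisation by the hook product)] -/
theorem prod_hookLength_rectangle (n δ : ℕ) :
    ∏ c ∈ (Nat.Partition.rectangle n δ).youngDiagram.cells,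
        hookLength (Nat.Partition.rectangle n δ).youngDiagram c =
      ∏ i ∈ Finset.range δ, ∏ j ∈ Finset.range n, (i + 1 + (j + 1) - 1) := by
  rw [cells_rectangle, Finset.prod_product, Finset.prod_comm]
  -- rewrite the hooks
  have h1 : ∏ b ∈ Finset.range δ, ∏ a ∈ Finset.range n,
      hookLength (Nat.Partition.rectangle n δ).youngDiagram (a, b) =
      ∏ b ∈ Finset.range δ, ∏ a ∈ Finset.range n, ((n - 1 - a) + (δ - 1 - b) + 1) := by
    refine Finset.prod_congr rfl fun b hb => Finset.prod_congr rfl fun a ha => ?_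
    rw [Finset.mem_range] at ha hb
    rw [hookLength, rowLen_rectangle ha, colLen_rectangle hb]
    omega
  rw [h1]
  -- reflect `b ↦ δ - 1 - b` and `a ↦ n - 1 - a`
  have e1 : ∏ b ∈ Finset.range δ, ∏ a ∈ Finset.range n, (n - 1 - a + (δ - 1 - b) + 1) =
      ∏ b ∈ Finset.range δ, ∏ a ∈ Finset.range n, (n - 1 - a + b + 1) :=
    Finset.prod_range_reflect (fun b => ∏ a ∈ Finset.range n, (n - 1 - a + b + 1)) δ
  have e2 : ∀ b, ∏ a ∈ Finset.range n, (n - 1 - a + b + 1) = ∏ a ∈ Finset.range n, (a + b + 1) :=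
    fun b => Finset.prod_range_reflect (fun a => a + b + 1) n
  rw [e1]
  simp_rw [e2]
  exact Finset.prod_congr rfl fun b _ => Finset.prod_congr rfl fun a _ => by omega

/-- **`f^{δⁿ} · ∏_{i=1}^{δ} ∏_{j=1}^{n} (i + j - 1) = (nδ)!`** (hook length formula for the
rectangle; tree `numStandardTableaux_mul_prod_hookLength_holds`).
[cite: FrameRobinsonThrallCJM1954, Theorem 1] -/
theorem numStandardTableaux_rectangle_mul_prod (n δ : ℕ) :
    numStandardTableaux (Nat.Partition.rectangle n δ) *
        ∏ i ∈ Finset.range δ, ∏ j ∈ Finset.range n, (i + 1 + (j + 1) - 1) = (n * δ).factorial := by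
  rw [← prod_hookLength_rectangle]
  exact numStandardTableaux_mul_prod_hookLength_holds (d := n * δ) (Nat.Partition.rectangle n δ)

/-- `χ^μ(1) = f^μ` over `ℂ`. [cite: FultonHarrisGTM129, (4.11) and Problem 4.47] -/
theorem spechtCharacter_one_eq_numStandardTableaux {D : ℕ} (μ : Nat.Partition D) :
    spechtCharacter ℂ μ 1 = (numStandardTableaux μ : ℂ) := by
  rw [spechtCharacter, Representation.char_one, finrank_spechtIdeal_holds ℂ μ]

end Hook

/-! ### §6 Assembly: Stanley's formula for the rectangle `δⁿ` -/

section Assembly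

variable {D : ℕ}

/-- `u ↦ x^{κ(u)}` is a class function on `𝔖_D`. [folklore] -/
private theorem isClassFun_pow_card_parts (x : ℂ) :
    IsClassFun (fun u : Equiv.Perm (Fin D) => x ^ (Equiv.Perm.partition u).parts.card) := by
  intro s t
  simp only [card_parts_partition_conj]

/-- `∑_g N^{κ(g)} χ^μ(g) = ∑_g χ_{(ℂ^N)^{⊗D}}(g) χ^μ(g)`. [folklore] -/
private theorem sum_pow_mul_spechtCharacter (N : ℕ) (μ : Nat.Partition D) :
    ∑ g : Equiv.Perm (Fin D), (N : ℂ) ^ (Equiv.Perm.partition g).parts.card * spechtCharacter ℂ μ g =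
      ∑ g : Equiv.Perm (Fin D), (wordPermRep ℂ N D).character g * spechtCharacter ℂ μ g := by
  simp_rw [character_wordPermRep_eq_pow]

/-- **The sign twist**: `∑_g (-N)^{κ(g)} χ^μ(g) = (-1)^D ∑_g χ_{(ℂ^N)^{⊗D}}(g) χ^{μᵀ}(g)`
(`(-1)^{κ} = (-1)^D sgn`, `sgn · χ^μ = χ^{μᵀ}`). [cite: JamesLNM682, 6.6] -/
private theorem sum_neg_pow_mul_spechtCharacter (N : ℕ) (μ : Nat.Partition D) :
    ∑ g : Equiv.Perm (Fin D), (-(N : ℂ)) ^ (Equiv.Perm.partition g).parts.card *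
        spechtCharacter ℂ μ g =
      (-1) ^ D * ∑ g : Equiv.Perm (Fin D), (wordPermRep ℂ N D).character g *
        spechtCharacter ℂ μ.transpose g := by
  rw [Finset.mul_sum]
  refine Finset.sum_congr rfl fun g _ => ?_
  rw [neg_pow, neg_one_pow_card_parts_partition, character_wordPermRep_eq_pow,
    spechtCharacter_transpose]
  ring

/-- Lemma `sum_character_wordPermRep_mul_spechtCharacter_rectangle` for any partition with the
parts of a rectangle (transport along `D = m d`). [cite: FultonHarrisGTM129, Thm. 6.3 (2),(4)] -/
theorem sum_character_wordPermRep_mul_spechtCharacter_of_parts_eq {m d : ℕ} (μ : Nat.Partition D)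
    (h : μ.parts = (Nat.Partition.rectangle m d).parts) :
    ∑ σ : Equiv.Perm (Fin D), (wordPermRep ℂ m D).character σ * spechtCharacter ℂ μ σ =
      ((D.factorial : ℕ) : ℂ) := by
  have hD : D = m * d := by rw [← μ.parts_sum, h, (Nat.Partition.rectangle m d).parts_sum]
  subst hD
  have hμ : μ = Nat.Partition.rectangle m d := Nat.Partition.ext h
  subst hμ
  exact sum_character_wordPermRep_mul_spechtCharacter_rectangle m d

/-- **BLMW 2011 §8.3 / Stanley 2003, Thm. 1 — Stanley's character formula for rectangular shapes,
discharged** (the named fact `BLMW2011_stanley_rectangularCharacter`, in its A13-corrected form):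
for `w ∈ 𝔖_{δn}`,
`(∏_{i ≤ δ, j ≤ n} (i + j - 1)) · χ_{δⁿ}(w) = (-1)^{δn} ∑_{uv = w} n^{κ(u)} (-δ)^{κ(v)}`.
Proof (Frobenius, through the group algebra; Stanley's own proof goes through symmetric
functions): `u ↦ n^{κ(u)}` is the character of `𝔖_D` on `(ℂⁿ)^{⊗D}` and
`(-δ)^{κ(v)} = (-1)^D sgn(v) δ^{κ(v)}` (§1), so the right-hand sum is a convolution of class
functions, `= ∑_λ A_λ B_λ χ^λ(w)/(f^λ D!)` with `A_λ = ∑ n^{κ} χ^λ`,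
`B_λ = (-1)^D ∑ δ^{κ} χ^{λᵀ}` (§3); by Schur–Weyl (§2) `A_λ = 0` unless `ℓ(λ) ≤ n` and `B_λ = 0`
unless `λ₁ ≤ δ`, so only `λ = δⁿ` survives (§4), with `A = D!`, `B = (-1)^D D!`
(`S_{δⁿ}(ℂⁿ) = det^{⊗δ}` and `S_{n^δ}(ℂ^δ) = det^{⊗n}` are one-dimensional); finally
`D!/f^{δⁿ}` is the hook product (§5). [cite: BurgisserEtAl2011, §8.3 (Stanley's character formula)]
[cite: Stanley2003Rectangular, Thm. 1] -/
theorem BLMW2011_stanley_rectangularCharacter_holds : BLMW2011_stanley_rectangularCharacter := by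
  intro n δ w
  have hθ := isClassFun_pow_card_parts (D := n * δ) (n : ℂ)
  have hψ := isClassFun_pow_card_parts (D := n * δ) (-(δ : ℂ))
  have hS : ∑ u : Equiv.Perm (Fin (n * δ)), (n : ℂ) ^ (Equiv.Perm.partition u).parts.card *
      (-(δ : ℂ)) ^ (Equiv.Perm.partition (u⁻¹ * w)).parts.card =
      ∑ μ : Nat.Partition (n * δ),
        (∑ g, (n : ℂ) ^ (Equiv.Perm.partition g).parts.card * spechtCharacter ℂ μ g) *
        (∑ g, (-(δ : ℂ)) ^ (Equiv.Perm.partition g).parts.card * spechtCharacter ℂ μ g) *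
          spechtCharacter ℂ μ w / (spechtCharacter ℂ μ 1 * ((n * δ).factorial : ℂ)) :=
    sum_mul_apply_inv_mul_eq_sum_partition hθ hψ w
  rw [hS, Finset.sum_eq_single (Nat.Partition.rectangle n δ)]
  · -- the main term
    rw [sum_pow_mul_spechtCharacter, sum_neg_pow_mul_spechtCharacter,
      sum_character_wordPermRep_mul_spechtCharacter_rectangle,
      sum_character_wordPermRep_mul_spechtCharacter_of_parts_eq _ (parts_transpose_rectangle n δ),
      spechtCharacter_one_eq_numStandardTableaux]
    have hH : (numStandardTableaux (Nat.Partition.rectangle n δ) : ℂ) *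
        (∏ i ∈ Finset.range δ, ∏ j ∈ Finset.range n, ((i + 1 + (j + 1) - 1 : ℕ) : ℂ)) =
        (((n * δ).factorial : ℕ) : ℂ) := by
      exact_mod_cast numStandardTableaux_rectangle_mul_prod n δ
    have hf : (numStandardTableaux (Nat.Partition.rectangle n δ) : ℂ) ≠ 0 := by
      rw [← spechtCharacter_one_eq_numStandardTableaux]
      exact (isIrrChar_spechtCharacter _).apply_one_ne_zero
    have hD : (((n * δ).factorial : ℕ) : ℂ) ≠ 0 := Nat.cast_ne_zero.mpr (Nat.factorial_ne_zero _)
    have hsign : (-1 : ℂ) ^ (δ * n) * (-1) ^ (n * δ) = 1 := by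
      rw [← pow_add, mul_comm δ n, ← two_mul, pow_mul, neg_one_sq, one_pow]
    rw [← hH]
    field_simp
    linear_combination (-((∏ i ∈ Finset.range δ, ∏ j ∈ Finset.range n, ((i + 1 + (j + 1) - 1 : ℕ) : ℂ)) *
      spechtCharacter ℂ (Nat.Partition.rectangle n δ) w)) * hsign
  · -- every other partition contributes zero
    intro μ _ hne
    rw [sum_pow_mul_spechtCharacter, sum_neg_pow_mul_spechtCharacter]
    by_cases h1 : n < μ.parts.card
    · rw [sum_character_wordPermRep_mul_spechtCharacter_eq_zero μ h1]
      simp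
    by_cases h2 : δ < μ.transpose.parts.card
    · rw [sum_character_wordPermRep_mul_spechtCharacter_eq_zero μ.transpose h2]
      simp
    exfalso
    exact hne (Nat.Partition.ext (parts_eq_rectangle_of_box μ rfl (not_lt.1 h1)
      (forall_parts_le_of_card_parts_transpose_le μ (not_lt.1 h2))))
  · exact fun h => absurd (Finset.mem_univ _) h

end Assembly

end Literature.Computability.AlgebraicComplexity
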